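import Summits.HubbardSuperconductivity.HubbardSuperconductivity.Theorems.WcbcsSsbToTorusLRO.Negative.FacePurityDissection
import Summits.HubbardSuperconductivity.HubbardSuperconductivity.Theorems.ChiralWindowCwSsbToEvenTorusLROBlockSlope
import Summits.HubbardSuperconductivity.HubbardSuperconductivity.Theorems.ChiralWindowCwSsbToEvenTorusLROSourceRemoval
import Summits.HubbardSuperconductivity.HubbardSuperconductivity.Theorems.ChiralWindowCwSsbToEvenTorusLROSectorFloorGC
import Summits.HubbardSuperconductivity.HubbardSuperconductivity.Theorems.AposterioriCapRgSsbToEvenTorusLroFacePurityOfRepelledOrder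
import Literature.MathematicalPhysics.QuantumLattice.DWaveOrderParameterProofs
import Literature.MathematicalPhysics.QuantumLattice.DWaveSourceProofs
import Literature.MathematicalPhysics.QuantumLattice.HubbardGrandCanonicalDensity
import HarnessLib

/-!
# Crux `WcbcsSsbToTorusLRO` (stmt-HubbardSuperconductivity-2009), line `off-zero-mode-moment-closure` ⊕ `neutral-curvature-face-purity`:
# the FACE-PURITY HALF closed modulo the neutral-curvature floor (N), and the crux closed modulo (T), (N), (C) + item 9491

1. `derivFacePurity_of_neutralCurvature` — at fixed `(U, δ, μ)` under the crux hypotheses (density matching at `μ`,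
   Koma–Tasaki order), the OPEN physical input (N) (for every block scale `R` an `h`-uniform floor `−C_R κ² L²` on the
   second difference `f(h,κ) + f(h,−κ) − 2f(h,0)` of the sourced grand-canonical torus ground energy
   `f(h,κ) = E₀(T_h + κ W_R)` in the Kac-block direction, for all small `κ, h`, eventually in the side) together with a
   supporting potential at `(U, δ)` (the body of item stmt-HubbardSuperconductivity-9491
   `AbsenceCertificate.CanonicalSupportingPotential`) yields DERIVATIVE FACE PURITY at `(U, δ)` — every normalised
   `(N_L, S^z=0)` ground state has block coherence `≥ (m²/16) L²` at every scale `R`, eventually along even sides — the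
   hypothesis `hP` of the landed `Negative.FacePurityDissection.floor_of_deriv_of_leak`. Chain (Transfer A of the
   Griffiths block slope at FINITE `L` in the GRAND-CANONICAL ground space, Census-r2-ideator5 §3(a)): attractive chord at
   base `0` (`CwSsbToEvenTorusLRO.stub_blockSlope`, landed), (N), source removal twice (`stub_sourceRemoval`, landed), the
   order VALUE `d_L(h) > m/2` (`dWaveOrderParameter_le_liminf`), Danskin for the canonical ground state as a trial state of
   `K_μ + κ W_R` (`stub_sectorFloorGC`, landed, + the sector variational line) with excess controlled by canonical/GC
   equivalence at the crux's OWN `μ`, obtained from the supporting potential `μ'` by Griffiths recentring under density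
   matching (the landed `fp_canonicalGCEquivalence_of_csp_of_densityMatched` of the sibling 1315 file). Real bookkeeping:
   `transferA_arith` (`κ ≤ (m/2)²/(2(C_R+24)+1)`, `h = min(h₀/2, κ²)`, CGE resolution `κ(m/2)²/4`).
2. (companion file `…Reduction.lean`) `wcbcsSsbToTorusLRO_of_stiffness_curvature_charging` — the crux BY NAME from the three
   open inputs (T), (N), (C) of the line and item 9491, through this file, `…InfraredHalf.lean` and the landed
   `floor_of_deriv_of_leak` + `hasDWavePairFieldLROAt_of_floor`.
References: Koma–Tasaki, J. Stat. Phys. 76 (1994) 745, §1; Griffiths, J. Math. Phys. 5 (1964) 1215 (chord/derivative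
inequalities for concave functions).
-/

noncomputable section

set_option linter.dupNamespace false

namespace Summit.HubbardSuperconductivity.HubbardSuperconductivity.Theorems.WcbcsSsbToTorusLRO

open Literature.MathematicalPhysics.QuantumLattice Literature.Probability.LatticeModels
open Matrix Filter Set
open scoped ComplexOrder ComplexConjugate

/-! ### The order VALUE and the real bookkeeping of Transfer A -/

/-- Unpacking `HasDWaveOrder` (tree `dWaveOrderParameter_le_liminf`: the `h`-liminf is an infimum; the inner sequence
is bounded below by `0`): for every source `s > 0`, eventually in the side `n + 1` the sourced tracial density exceeds
`m/2`, `m = dWaveOrderParameter U μ`. -/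
theorem eventually_half_lt_density (U μ : ℝ) (hord : HasDWaveOrder U μ) {s : ℝ} (hs : 0 < s) :
    ∀ᶠ n : ℕ in atTop, dWaveOrderParameter U μ / 2 < dWaveSourceDensity (n + 1) U μ s := by
  have hle := dWaveOrderParameter_le_liminf U μ hs
  have hm : 0 < dWaveOrderParameter U μ := hord
  refine Filter.eventually_lt_of_lt_liminf (lt_of_lt_of_le (by linarith) hle) ?_
  exact isBoundedUnder_of_eventually_ge (a := 0)
    (Eventually.of_forall fun n => dWaveSourceDensity_nonneg U μ hs.le)

/-- **Real bookkeeping of Transfer A** on one side (`A = L² > 0`). `Fhκ, Fhm, Fh0` are the SOURCED GC energies at block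
couplings `κ, −κ, 0`; `F0κ, F00` the source-free ones; `S` the sector energy of `H` at `N_L`; `x = A·d` the sourced tracial pair
amplitude at coupling `0`; `w` the block coherence of the canonical ground state. Inputs in order: S1 (base `0`, step `κ`), N,
S4 twice, S5 + sector variational line (`F0κ + μN − S ≤ κ w`), CGE, the floor `dmin ≤ d`, and the choices
`(C + 24) κ ≤ dmin²/2`, `h ≤ κ²`, `ε = κ dmin²/4`. Output: `(dmin²/4)·A ≤ w`. -/
theorem transferA_arith {Fhκ Fhm Fh0 F0κ F00 S μN x d dmin w A C κ h ε : ℝ}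
    (hA : 0 < A) (hκ : 0 < κ) (_hh : 0 < h) (_hC : 0 ≤ C) (hdmin : 0 ≤ dmin)
    (hS1 : Fhm - Fh0 ≤ -κ * x ^ 2 / A) (hN : -C * κ ^ 2 * A ≤ Fhκ + Fhm - 2 * Fh0)
    (hS4a : |Fhκ - F0κ| ≤ 12 * h * A) (hS4b : |Fh0 - F00| ≤ 12 * h * A)
    (hvar : F0κ + μN - S ≤ κ * w) (hcge : S - μN - F00 ≤ ε * A)
    (hx : x = A * d) (hd : dmin ≤ d) (hκC : (C + 24) * κ ≤ dmin ^ 2 / 2) (hhκ : h ≤ κ ^ 2)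
    (hε : ε = κ * dmin ^ 2 / 4) :
    dmin ^ 2 / 4 * A ≤ w := by
  subst hx hε
  have h4a := abs_le.mp hS4a
  have h4b := abs_le.mp hS4b
  -- the attractive chord at base 0: Fh0 - Fhm ≥ κ A d²
  have hd2 : dmin ^ 2 ≤ d ^ 2 := pow_le_pow_left₀ hdmin hd 2
  have hchord0 : κ * A * d ^ 2 ≤ Fh0 - Fhm := by
    have e : -κ * (A * d) ^ 2 / A = -(κ * A * d ^ 2) := by
      field_simp
    rw [e] at hS1
    linarith
  -- hence the repulsive chord of the sourced energy, then of the source-free energy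
  have hchordh : κ * A * d ^ 2 - C * κ ^ 2 * A ≤ Fhκ - Fh0 := by nlinarith
  have hchord : κ * A * d ^ 2 - C * κ ^ 2 * A - 24 * h * A ≤ F0κ - F00 := by linarith [h4a.1, h4a.2, h4b.1, h4b.2]
  -- Danskin for the canonical ground state, with the CGE excess
  have hw : κ * A * d ^ 2 - C * κ ^ 2 * A - 24 * h * A - κ * dmin ^ 2 / 4 * A ≤ κ * w := by linarith
  -- arithmetic of the choices
  have h24 : 24 * h ≤ 24 * κ ^ 2 := by linarith
  have hkey : κ * (dmin ^ 2 / 4 * A) ≤ κ * w := by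
    have hAκ : 0 ≤ κ * A := by positivity
    nlinarith [mul_le_mul_of_nonneg_left hd2 hAκ, mul_le_mul_of_nonneg_left hκC (mul_nonneg hκ.le hA.le),
      mul_le_mul_of_nonneg_right h24 hA.le]
  exact le_of_mul_le_mul_left hkey hκ

/-- The sector variational line for an eigenvector: `minEnergyOn (H + κW) K ≤ E + κ Re⟨ψ, Wψ⟩` for a unit `ψ ∈ K`
with `Hψ = Eψ`. -/
theorem sector_variational_line {n : Type*} [Fintype n] (H W : Matrix n n ℂ) (K : Submodule ℂ (n → ℂ)) (κ : ℝ)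
    {ψ : n → ℂ} (hψK : ψ ∈ K) (hψ1 : star ψ ⬝ᵥ ψ = 1) {E : ℝ} (heig : H *ᵥ ψ = ((E : ℝ) : ℂ) • ψ) :
    (H + (κ : ℂ) • W).minEnergyOn K ≤ E + κ * (star ψ ⬝ᵥ W *ᵥ ψ).re := by
  have h1 := minEnergyOn_le_re_rayleigh (H + (κ : ℂ) • W) K hψK hψ1
  have e : (star ψ ⬝ᵥ (H + (κ : ℂ) • W) *ᵥ ψ).re = E + κ * (star ψ ⬝ᵥ W *ᵥ ψ).re := by
    rw [add_mulVec, dotProduct_add, smul_mulVec, dotProduct_smul, heig, dotProduct_smul, hψ1]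
    simp
  linarith [h1, e.le, e.ge]

/-! ### The face-purity half -/

/-- **Derivative face purity at `(U, δ)` from the neutral-curvature floor (N), a supporting potential, density matching
and Koma–Tasaki order** (shape `hP` of the landed `floor_of_deriv_of_leak`; floor `a = (m/2)²/4 = m²/16`, independent of
the block scale `R`). -/
theorem derivFacePurity_of_neutralCurvature :
    ∀ (U δ μ : ℝ), δ ∈ Set.Ioo (0:ℝ) (1 / 2) → (∀ R : ℕ, 0 < R → ∃ C : ℝ, 0 ≤ C ∧ ∃ κ₀ : ℝ, 0 < κ₀ ∧ ∃ h₀ : ℝ, 0 < h₀ ∧ ∀ κ ∈ Set.Ioo (0:ℝ) κ₀, ∀ h ∈ Set.Ioo (0:ℝ) h₀, ∀ᶠ L : ℕ in Filter.atTop, -C * κ ^ 2 * ((L + 1 : ℕ) : ℝ) ^ 2 ≤ (dWaveSourceTorus (L + 1) U μ h + (κ : ℂ) • (((((R : ℝ) ^ 4)⁻¹ : ℝ) : ℂ) • ∑ a : Literature.Probability.LatticeModels.TorusSite 2 (L + 1), (∑ u : Fin 2 → Fin R, localPair dWaveFormFactor (L + 1) (a + fun i => ((u i : ℕ) : ZMod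 (L + 1))))ᴴ * (∑ u : Fin 2 → Fin R, localPair dWaveFormFactor (L + 1) (a + fun i => ((u i : ℕ) : ZMod (L + 1)))))).groundEnergy + (dWaveSourceTorus (L + 1) U μ h + ((-κ : ℝ) : ℂ) • (((((R : ℝ) ^ 4)⁻¹ : ℝ) : ℂ) • ∑ a : Literature.Probability.LatticeModels.TorusSite 2 (L + 1), (∑ u : Fin 2 → Fin R, localPair dWaveFormFactor (L + 1) (a + fun i => ((u i : ℕ) : ZMod (L + 1))))ᴴ * (∑ u : Fin 2 → Fin R, localPair dWaveFormFactor (L + 1) (a + fun i => ((u i : ℕ) : ZMod (L + 1)))))).groundEnergy - 2 * (dWaveSourceTorus (L + 1) U μ h).groundEnergy) → (∃ μ' : ℝ, ∀ ε : ℝ, 0 < ε → ∃ L₀ : ℕ, ∀ L : ℕ, Even L → L₀ ≤ L → |(hubbardTorus 2 L 1 U).minEnergyOn (szSector (2 * ⌊(1 - δ) * (L : ℝ) ^ 2 / 2⌋₊) 0) - μ' * ((2 * ⌊(1 - δ) * (L : ℝ) ^ 2 / 2⌋₊ : ℕ) : ℝ) - Matrix.groundEnergy (hubbardTorusWith 2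 L 1 U μ')| ≤ ε * (L : ℝ) ^ 2) → Filter.Tendsto (fun L : ℕ => ((hubbardTorusWith 2 (L + 1) 1 U μ).groundStateFunctional totalNumber).re / ((L + 1 : ℕ) : ℝ) ^ 2) Filter.atTop (nhds (1 - δ)) → HasDWaveOrder U μ → ∃ a : ℝ, 0 < a ∧ ∀ R : ℕ, 0 < R → ∀ᶠ k : ℕ in Filter.atTop, ∀ ψ : Fock (Orb (FermionTorus 2 (2 * k + 1 + 1))), IsGroundStateInSector (hubbardTorus 2 (2 * k + 1 + 1) 1 U) (2 * ⌊(1 - δ) * (((2 * k + 1 + 1) : ℕ) : ℝ) ^ 2 / 2⌋₊) 0 ψ → star ψ ⬝ᵥ ψ = 1 → a * ((2 * k + 1 + 1 : ℕ) : ℝ) ^ 2 ≤ (star ψ ⬝ᵥ ((((((R : ℝ) ^ 4)⁻¹ : ℝ) : ℂ) • ∑ a : Literature.Probability.LatticeModels.TorusSite 2 (2 * k + 1 + 1), ((∑ u : Fin 2 → Fin R, localPair dWaveFormFactor ((2 * k + 1 + 1)) (a + fun i => ((u i : ℕ) : ZMod ((2 * k + 1 + 1))))))ᴴ * ((∑ u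 : Fin 2 → Fin R, localPair dWaveFormFactor ((2 * k + 1 + 1)) (a + fun i => ((u i : ℕ) : ZMod ((2 * k + 1 + 1)))))))) *ᵥ ψ).re := by
  intro U δ μ hδ hNR hCSP hdm hord
  have hδ1 : δ ≤ 1 := by linarith [hδ.2]
  have hδ0 : 0 ≤ δ := hδ.1.le
  -- the order VALUE and the floor
  set m : ℝ := dWaveOrderParameter U μ with hm_def
  have hm : 0 < m := hord
  set dmin : ℝ := m / 2 with hdmin_def
  have hdmin : 0 < dmin := by positivity
  -- canonical/GC equivalence at μ from item 9491 + DM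
  have hcge := fp_canonicalGCEquivalence_of_csp_of_densityMatched (U := U) (μ := μ) hδ1 hCSP hdm
  refine ⟨dmin ^ 2 / 4, by positivity, fun R hR => ?_⟩
  -- stub N at scale R
  obtain ⟨C, hC, κ₀, hκ₀, h₀, hh₀, hN⟩ := hNR R hR
  -- the block coupling and the source strength
  set κ : ℝ := min (κ₀ / 2) (dmin ^ 2 / (2 * (C + 24) + 1)) with hκ_def
  have hC24 : 0 < 2 * (C + 24) + 1 := by linarith
  have hκpos : 0 < κ := lt_min (by positivity) (by positivity)
  have hκIoo : κ ∈ Set.Ioo (0:ℝ) κ₀ := ⟨hκpos, lt_of_le_of_lt (min_le_left _ _) (by linarith)⟩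
  have hκC : (C + 24) * κ ≤ dmin ^ 2 / 2 := by
    have h1 : κ ≤ dmin ^ 2 / (2 * (C + 24) + 1) := min_le_right _ _
    have h2 : (C + 24) * κ ≤ (C + 24) * (dmin ^ 2 / (2 * (C + 24) + 1)) :=
      mul_le_mul_of_nonneg_left h1 (by linarith)
    have h3 : (C + 24) * (dmin ^ 2 / (2 * (C + 24) + 1)) ≤ dmin ^ 2 / 2 := by
      rw [mul_div_assoc', div_le_div_iff₀ hC24 (by norm_num : (0:ℝ) < 2)]
      nlinarith [sq_nonneg dmin]
    exact h2.trans h3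
  set h : ℝ := min (h₀ / 2) (κ ^ 2) with hh_def
  have hhpos : 0 < h := lt_min (by positivity) (by positivity)
  have hhIoo : h ∈ Set.Ioo (0:ℝ) h₀ := ⟨hhpos, lt_of_le_of_lt (min_le_left _ _) (by linarith)⟩
  have hhκ : h ≤ κ ^ 2 := min_le_right _ _
  -- N and the order value on the even sides `2k+2 = (2k+1)+1`; CGE at resolution κ dmin²/4
  have h2k1 : Tendsto (fun k : ℕ => 2 * k + 1) atTop atTop := by
    refine tendsto_atTop_mono (fun k => ?_) tendsto_id
    simp only [id]; omega
  have hNev := h2k1.eventually (hN κ hκIoo h hhIoo)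
  have hOev := h2k1.eventually (eventually_half_lt_density U μ hord hhpos)
  obtain ⟨L₁, hL₁⟩ := hcge (κ * dmin ^ 2 / 4) (by positivity)
  filter_upwards [hNev, hOev, eventually_ge_atTop L₁] with k hNk hOk hkL
  intro ψ hψ hψ1
  have hEven : Even (2 * k + 1 + 1) := ⟨k + 1, by ring⟩
  have hL₁' : L₁ ≤ 2 * k + 1 + 1 := by omega
  have hcgek := hL₁ (2 * k + 1 + 1) hL₁' hEven
  -- S1 at base 0, step κ
  have hS1 := CwSsbToEvenTorusLRO.stub_blockSlope (2 * k + 1 + 1) R hR U μ h 0 κ hκpos.le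
  rw [zero_sub, Complex.ofReal_zero, zero_smul, add_zero] at hS1
  -- S4 at κ and at 0
  have hS4a := CwSsbToEvenTorusLRO.stub_sourceRemoval (2 * k + 1 + 1) R U μ h κ
  have hS4b := CwSsbToEvenTorusLRO.stub_sourceRemoval (2 * k + 1 + 1) R U μ h 0
  rw [Complex.ofReal_zero, zero_smul, add_zero, add_zero] at hS4b
  rw [abs_of_pos hhpos] at hS4a hS4b
  -- S5 in the sector N_L (non-empty: ψ) and the sector variational line
  have hS5 := CwSsbToEvenTorusLRO.stub_sectorFloorGC (2 * k + 1 + 1) R U μ κ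
    (2 * ⌊(1 - δ) * (((2 * k + 1 + 1 : ℕ) : ℕ) : ℝ) ^ 2 / 2⌋₊) ⟨ψ, hψ.1, hψ.2.1⟩
  have hvarK := sector_variational_line (hubbardTorus 2 (2 * k + 1 + 1) 1 U)
    ((((((R : ℝ) ^ 4)⁻¹ : ℝ) : ℂ) • ∑ a : Literature.Probability.LatticeModels.TorusSite 2 (2 * k + 1 + 1), (∑ u : Fin 2 → Fin R, localPair dWaveFormFactor (2 * k + 1 + 1) (a + fun i => ((u i : ℕ) : ZMod (2 * k + 1 + 1))))ᴴ * (∑ u : Fin 2 → Fin R, localPair dWaveFormFactor (2 * k + 1 + 1) (a + fun i => ((u i : ℕ) : ZMod (2 * k + 1 + 1))))))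
    _ κ hψ.1 hψ1 hψ.2.2
  -- the sourced tracial amplitude is A · d
  have hA : (0 : ℝ) < (((2 * k + 1 + 1 : ℕ) : ℕ) : ℝ) ^ 2 := by positivity
  have hx : ((dWaveSourceTorus (2 * k + 1 + 1) U μ h).groundStateFunctional
      (pairField dWaveFormFactor (2 * k + 1 + 1))).re =
      (((2 * k + 1 + 1 : ℕ) : ℕ) : ℝ) ^ 2 * dWaveSourceDensity (2 * k + 1 + 1) U μ h := by
    unfold dWaveSourceDensity
    field_simp
  exact transferA_arith (μN := μ * ((2 * ⌊(1 - δ) * (((2 * k + 1 + 1 : ℕ) : ℕ) : ℝ) ^ 2 / 2⌋₊ : ℕ) : ℝ))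
    hA hκpos hhpos hC hdmin.le hS1 hNk hS4a hS4b (by linarith) hcgek hx hOk.le hκC hhκ rfl

end Summit.HubbardSuperconductivity.HubbardSuperconductivity.Theorems.WcbcsSsbToTorusLRO

end
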